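import Literature.NumberTheory.EllipticCurves.Kato2004.LocalIwasawaCohomologyMap
import Literature.NumberTheory.EllipticCurves.KatoFineSelmerDual
import Literature.NumberTheory.EllipticCurves.GreenbergStrictSelmerDualProofs
import Literature.NumberTheory.EllipticCurves.Castella2018.AnticyclotomicSelmer
import Literature.NumberTheory.EllipticCurves.HeegnerPoints
import Literature.NumberTheory.EllipticCurves.QuadraticTwist
import HarnessLib

/-!
# Route `TwoAdicConverse`, crux `OrdLambdaHalfAtTwo` (stmt-BirchSwinnertonDyer-19556), line `kato_determinant_greenberg_two` v4.3 — the TWO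
# non-Kato supply pieces of stub 4″ `ShapiroKatoGreenbergSupplyAtTwo` DISPLAYED BY NAME (memo tier, pen RC-362 (B) tier rule t2/t3):
# (S) λ-Shapiro for the fine duals, (PT) Poitou–Tate over `K_∞` with the Shapiro lattice and loc-injectivity under cotorsion

Seat `bsd-2adic-conv-1` GEN 28 (cell `pub/bsd-2adic`; `--supports stmt-BirchSwinnertonDyer-19556`).  HONEST FRAMING: BSD is not proved by any of this;
the crux is NOT proved here; the two definitions below are OPEN statements displayed by name — READINGS at `p = 2` of Shapiro's lemma /
inflation–restriction / Imai's finiteness / the Poitou–Tate five-term sequence for Selmer structures / Greenberg's rank formula — and by the pen's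
TIER RULE (RC-362 (B)) they are NOT Literature facts: (S) is anchor-less folklore at `2` (t3: «EITHER proved in the kernel as module algebra … OR a
Theorems-side memo-tier `@[conjecture] def` consumed by 4″ exactly like K4's `SteinbergFibreAtTwo.HasZetaColemanMuInputsAtTwo`»), and (PT)'s
`∃ L` device is PACKAGING (t2: «THEOREMS-side KERNEL (sorry-free lemmas from the t1 facts), never a fact» — not yet possible: the tree has no
`K`-level global Iwasawa-cohomology carrier `H¹_Iw(K_Σ/K, T₂W)` with `loc_w̄` and `res`, so the t1 Poitou–Tate fact over `K` cannot be stated; this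
binder is the interim).  Nothing asserted.  Companion: the Kato pieces of 4″ ARE a Literature t1 fact, PER CURVE —
`Kato2004.exists_zetaClass_colemanMinus_recLaw_index_two` (`Kato2004/ZetaColemanMinusAtTwo.lean`, p681779, reviewer-accepted).  With it (for `W`
and for `A`), (S) and (PT), the lead's `ShapiroKatoGreenbergSupplyAtTwo` closes as `⟨…⟩` once `PinnedKatoCore.recA` is re-typed per curve (RC-362
(B) S1) and `isTorsion_quot` is derived in the kernel (S2); this file does not attempt that assembly.

CARRIERS: Literature only — `Castella2018.AcSelmer.bdpData` and `GreenbergSelmer.fineData` are DEFINITIONALLY the skeleton's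
`X11b.AcSelmer.bdpData (MK W K) 2 w` and `fineData W K` (`rfl`, checked on the farm), `LinearMap.range (J'.ordinaryInclusion J)` is
`localOrdinaryPart J' J`; so the lead converts by `rfl`.

## (S) READING — why `λ(X₀(W/K_∞)) = λ(X₀(W/ℚ_∞)) + λ(X₀(A/ℚ_∞))` (2 split in `K`)
`G = Gal(K/ℚ) = ⟨σ⟩` acts on `S := Sel₀(K_∞, W[2^∞])` (`K_∞ = K·ℚ_∞`).  Restriction gives `Sel₀(ℚ_∞, W[2^∞]) → S^{σ=+1}` and, through
`A[2^∞] ≅ W[2^∞] ⊗ ε_K`, `Sel₀(ℚ_∞, A[2^∞]) → S^{σ=−1}`, with kernel/cokernel inside `H^i(G, E(K_∞)[2^∞])` — FINITE by Imai [Imai1975].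
`S⁺ ∩ S⁻ ⊆ S[2]` and `S/(S⁺ + S⁻)` have exponent `2`.  Above `2` both sides impose TRIVIALITY at the decomposition groups and `K_{∞,w} = K_{∞,w̄} =
ℚ_{∞,2}`, so the conditions match exactly; at `η ∤ 2` local Shapiro [NeukirchSchmidtWingberg2008, (1.6.4)] matches «trivial on `H ⊓ D_η`» (the
tree's `strictSelmerInfty` on both sides) up to exponent-`2`/finite defects.  Dually the three `X₀`'s differ by f.g. torsion modules of `λ = 0`;
`λ` is additive.  `μ` does NOT transfer (triage Δ17-1: the Shapiro defect has `μ = 1` on `{Δ_W < 0}`).  KERNEL ROUTE (t3 preferred): res/cores on the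
tree's finite-level `subgroupH1` with kernel/cokernel killed by `[K:ℚ] = 2` ⇒ equal `λ` (L-sized; Imai's finiteness as a t1 fact).

## (PT) READING — the lattice, the sequence, loc-injectivity
`H := H¹_Iw(K_Σ/K, T₂W)`, `H^± := H^{σ=±1}`; inf–res (kernel `H¹(G, (T₂W)^{Γ_{K_∞}}) = 0`) gives `res 𝐇¹_Γ(T₂W) = H⁺`, `res 𝐇¹_Γ(T₂A) = H⁻` (the latter
through the geometric untwisting, locally `u_A`); `L := loc_w̄ H ≤ H¹_Iw(K_{∞,w̄}, T₂W) = J.H` (`K_w̄ = ℚ₂`) ⊇ `loc_w̄(H⁺ + H⁻) = range`, `2L ≤ range`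
(`2x = (x+σx) + (x−σx)`).  The five-term sequence [Rubin2000 Thm 1.7.3; MazurRubin2004 Thm 2.3.4] for fine `≤` BDP (differing only at `w̄`) over the
layers `K_n`, `E[2^k]`, in the limit: the image of `Sel_BDP` in `H¹(K_{∞,w̄}, E[2^∞])` is the annihilator of `loc_w̄ H`, so
`0 → J.H ⧸ L → X_Gr → X_fine → 0` is exact (no archimedean term: `K_n` totally imaginary).  Loc-injectivity: `ker(loc_w̄|H)` is the compact Selmer
group of the DUAL structure (relaxed at `w`, strict at `w̄`), of `Λ`-rank `corank Sel_BDP` [Greenberg2010 Prop 2.2.9 / 3.1.1 / Rem 3.1.2] — `0`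
under cotorsion — and torsion free, hence `0`; then `H⁺ ∩ H⁻ = 0`.  WANT (for t2 compliance): a Literature carrier for `H` with `loc_w̄`, `res_W`,
`res_A` (definition seat), then PT as a t1 fact over it and these clauses as kernel lemmas.

References: [NeukirchSchmidtWingberg2008] (1.6.4); [Imai1975]; [Rubin2000] Thm 1.7.3; [MazurRubin2004] Thm 2.3.4; [Greenberg2010] Prop 2.2.9, 3.1.1,
Rem 3.1.2; [Kato2004Asterisque] Thm 12.4 (2), §17.13; `Cruxes/OrdLambdaHalfAtTwo/TRIAGE-r1-1.md` Δ16-1/Δ17-1/Δ17-2/Δ18-1; p679221; seat BRIEF-19556-F3.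
-/

set_option autoImplicit false
set_option linter.dupNamespace false

open scoped NumberField
open Field IsDedekindDomain WeierstrassCurve
open Literature.NumberTheory.GaloisRepresentations
open Literature.NumberTheory.EllipticCurves Literature.NumberTheory.EllipticCurves.Kato2004
open Literature.NumberTheory.EllipticCurves.Kato2004.EulerSystemValues
open Literature.NumberTheory.EllipticCurves.Castella2018 (AcSelmer.bdpData)

namespace Summit.BirchSwinnertonDyer.BirchSwinnertonDyer.Theorems.TwoAdicShapiroPT

/-- [MEMO tier, OPEN — pen RC-362 (B)(t3): anchor-less folklore at `2`, to be PROVED in the kernel as module algebra or consumed as a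
displayed binder; NOT a Literature fact] **λ-SHAPIRO for fine Selmer duals under imaginary quadratic base change with `2` split (module
docstring (S)).**  For `W/ℚ` elliptic, `K` imaginary quadratic in which `2` splits (`SatisfiesHeegnerHypothesis 2 K`), a ℚ-model `A` of
the twist `W^{(d_K)}`, the cyclotomic `ℤ₂`-extensions of `ℚ` and of `K` with topological generators, the fine Selmer duals
`Y_W = X₀(W/ℚ_∞)`, `Y_A = X₀(A/ℚ_∞)` (finitely generated torsion) and the fine Greenberg dual `Dfi = X₀(W/K_∞)` (strict at every `v ∣ 2`,
tree `GreenbergSelmer.fineData`): `X₀(W/K_∞)` is finitely generated torsion and **`λ(X₀(W/K_∞)) = λ(X₀(W/ℚ_∞)) + λ(X₀(A/ℚ_∞))`**.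
Shapiro's lemma with inflation–restriction; the `λ`-currency absorbs the `±`-defects (exponent `2`) and the restriction defects (finite by
Imai); above `2` the local conditions agree exactly because `K_w = K_w̄ = ℚ₂`.  `μ` is NOT claimed to add (it does not: the Shapiro defect of the
cell's triage Δ17-1 has `μ = 1` on `{Δ_W < 0}`).  Nothing asserted.
-- TODO(general form): any quadratic `K` with `p` split, any `p`; odd `p` gives the `±`-decomposition on the nose.
[cite: NeukirchSchmidtWingberg2008, (1.6.4) (Shapiro's lemma)] [cite: Imai1975, Theorem (finiteness of torsion over the cyclotomic ℤ_p-extension)]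
[cite: Kato2004Asterisque, §17.13 (the fine Selmer group Sel₀ and 𝐇²; shape)] -/
@[conjecture] def LambdaShapiroFineAtTwo : Prop :=
  ∀ (W : WeierstrassCurve ℚ) [W.IsElliptic] (K : Type) [Field K] [NumberField K],
    IsImaginaryQuadratic K → SatisfiesHeegnerHypothesis 2 K →
    ∀ (A : WeierstrassCurve ℚ) [A.IsElliptic] (C : VariableChange ℚ),
      C • A = W.quadraticTwist ((NumberField.discr K : ℤ) : ℚ) →
    ∀ (κ : ZpExtension ℚ 2) (γ : absoluteGaloisGroup ℚ), κ.IsCyclotomic → κ.IsTopGenerator γ →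
    ∀ (κK : ZpExtension K 2) (γK : absoluteGaloisGroup K), κK.IsCyclotomic → κK.IsTopGenerator γK →
    ∀ (Y_W : W.FineSelmerDualData κ γ) (Y_A : A.FineSelmerDualData κ γ)
      (Dfi : (W.baseChange K).GreenbergStrictSelmerDualData κK γK
        (GreenbergSelmer.fineData (↥((W.baseChange K).geomPrimaryTorsion 2)) 2)),
      Module.Finite (IwasawaAlgebra 2) Y_W.X → Module.IsTorsion (IwasawaAlgebra 2) Y_W.X →
      Module.Finite (IwasawaAlgebra 2) Y_A.X → Module.IsTorsion (IwasawaAlgebra 2) Y_A.X →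
      (Module.Finite (IwasawaAlgebra 2) Dfi.X ∧ Module.IsTorsion (IwasawaAlgebra 2) Dfi.X) ∧
      lambdaInvariant 2 Dfi.X = lambdaInvariant 2 Y_W.X + lambdaInvariant 2 Y_A.X

/-- [MEMO tier, OPEN — pen RC-362 (B)(t2): PACKAGING of the printed Poitou–Tate sequence with the Shapiro lattice; to be replaced by
KERNEL lemmas from a t1 Poitou–Tate fact once a `K`-level global Iwasawa-cohomology carrier with `loc_w̄`/`res` exists; NOT a Literature fact]
**POITOU–TATE over `K_∞` for the BDP structure (strict at `w`, relaxed at `w̄`) with the SHAPIRO LATTICE, and loc-injectivity given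
cotorsion (module docstring (PT)).**  For `W/ℚ` elliptic, `K` imaginary quadratic with `2` split, `w ∣ 2`, a ℚ-model
`A` of `W^{(d_K)}`, the cyclotomic towers of `ℚ` and `K`, the place `v = (2)` of `ℚ` with a local generator lift, the pinned global carriers
`I_W = 𝐇¹_Γ(T₂W)`, `I_A = 𝐇¹_Γ(T₂A)`, the pinned local towers `J = 𝐇¹_{loc,Γ}(T₂W|_{Γ_ℚ₂})`, `J_A = 𝐇¹_{loc,Γ}(T₂A|_{Γ_ℚ₂})`, and the
Pontryagin duals `X_Gr` (Castella's data `bdpData _ 2 w`) and `X_fine` (`GreenbergSelmer.fineData`) of `W` over `K_∞`: there is a bijective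
local untwisting `u_A : T₂A|_{Γ_ℚ₂} ≅ T₂W|_{Γ_ℚ₂}` (intended: the geometric one, `2` split ⇒ `√d_K ∈ ℚ₂`) and a `Λ`-lattice `L ≤ J.H`
(intended: `loc_w̄ H¹_Iw(K_Σ/K, T₂W)`) with `range(loc_W ⊕ 𝐇¹(u_A)∘loc_A) ≤ L` and `2·L ≤ range` (Shapiro: `res 𝐇¹(T₂W) = H⁺`,
`res 𝐇¹(T₂A) = H⁻`, `2x = (x + σx) + (x − σx)`), a short exact sequence **`0 → J.H ⧸ L → X_Gr → X_fine → 0`** (the Poitou–Tate five-term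
sequence for the Selmer structures fine ⊂ BDP, which differ only at `w̄`, in the limit over `K_n ⊂ K_∞`; `K` totally imaginary ⇒ no
archimedean term), and, GIVEN `X_Gr` finitely generated TORSION, **`loc_W ⊕ 𝐇¹(u_A)∘loc_A` is injective** (the compact Selmer group of the dual
structure — relaxed at `w`, strict at `w̄` — has `Λ`-rank `= corank X_Gr = 0` and is torsion free, so vanishes; then `H⁺ ∩ H⁻ = 0`).
Nothing asserted.
-- TODO(general form): Poitou–Tate for an arbitrary pair of Selmer structures over a ℤ_p-extension of a number field, any `p`.
[cite: Rubin2000, Thm. 1.7.3 (the five-term global-duality sequence for Selmer structures F ⊂ G)] [cite: MazurRubin2004, Thm. 2.3.4]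
[cite: Greenberg2010, Prop. 3.1.1, Rem. 3.1.2, Prop. 2.2.9 (rank of the compact Selmer group of the dual structure; vanishing under cotorsion)]
[cite: Kato2004Asterisque, §17.13 (17.13.1)–(17.13.2) (the case over ℚ; shape)] [cite: NeukirchSchmidtWingberg2008, (1.6.4)] -/
@[conjecture] def ShapiroLatticePoitouTateAtTwo : Prop :=
  ∀ (W : WeierstrassCurve ℚ) [W.IsElliptic] [ContinuousSMul ℤ_[2] (W.tateModule 2)]
    (K : Type) [Field K] [NumberField K], IsImaginaryQuadratic K → SatisfiesHeegnerHypothesis 2 K →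
    ∀ (A : WeierstrassCurve ℚ) [A.IsElliptic] [ContinuousSMul ℤ_[2] (A.tateModule 2)] (C : VariableChange ℚ),
      C • A = W.quadraticTwist ((NumberField.discr K : ℤ) : ℚ) →
    ∀ (w : HeightOneSpectrum (𝓞 K)), ((2 : ℕ) : 𝓞 K) ∈ w.asIdeal →
    ∀ (κ : ZpExtension ℚ 2) (γ : absoluteGaloisGroup ℚ), κ.IsCyclotomic → ∀ (hγ : κ.IsTopGenerator γ),
    ∀ (κK : ZpExtension K 2) (γK : absoluteGaloisGroup K), κK.IsCyclotomic → κK.IsTopGenerator γK →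
    ∀ (v : HeightOneSpectrum (𝓞 ℚ)), ((2 : ℕ) : 𝓞 ℚ) ∈ v.asIdeal →
    ∀ (γᵥ : absoluteGaloisGroup (v.adicCompletion ℚ))
      (hsurj : Function.Surjective
        (κ.toContinuousMonoidHom.comp (resGalOfEmb (closureEmb (K := ℚ) (v.adicCompletion ℚ)))))
      (hγᵥ : κ.IsTopGenerator (resGalOfEmb (closureEmb (K := ℚ) (v.adicCompletion ℚ)) γᵥ))
      (I_W : IwasawaH1Data W 2 κ γ) (I_A : IwasawaH1Data A 2 κ γ)
      (J : LocalIwasawaH1Data κ v ((tateRep W 2).toLocal v) γᵥ)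
      (J_A : LocalIwasawaH1Data κ v ((tateRep A 2).toLocal v) γᵥ)
      (DGr : (W.baseChange K).GreenbergStrictSelmerDualData κK γK
        (AcSelmer.bdpData (↥((W.baseChange K).geomPrimaryTorsion 2)) 2 w))
      (Dfi : (W.baseChange K).GreenbergStrictSelmerDualData κK γK
        (GreenbergSelmer.fineData (↥((W.baseChange K).geomPrimaryTorsion 2)) 2)),
    ∃ (uA : ((tateRep A 2).toLocal v).toTopRep ⟶ ((tateRep W 2).toLocal v).toTopRep),
      Function.Bijective uA.hom ∧
      ∃ (L : Submodule (IwasawaAlgebra 2) J.H),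
        LinearMap.range ((I_W.loc J hsurj hγ hγᵥ).coprod (J_A.map uA J ∘ₗ I_A.loc J_A hsurj hγ hγᵥ)) ≤ L ∧
        (∀ y ∈ L, (2 : IwasawaAlgebra 2) • y ∈
          LinearMap.range ((I_W.loc J hsurj hγ hγᵥ).coprod (J_A.map uA J ∘ₗ I_A.loc J_A hsurj hγ hγᵥ))) ∧
        (∃ (δ : (J.H ⧸ L) →ₗ[IwasawaAlgebra 2] DGr.X) (π : DGr.X →ₗ[IwasawaAlgebra 2] Dfi.X),
          Function.Injective δ ∧ Function.Surjective π ∧ Function.Exact δ π) ∧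
        (Module.Finite (IwasawaAlgebra 2) DGr.X → Module.IsTorsion (IwasawaAlgebra 2) DGr.X →
          Function.Injective
            ((I_W.loc J hsurj hγ hγᵥ).coprod (J_A.map uA J ∘ₗ I_A.loc J_A hsurj hγ hγᵥ)))


/-! ## (PT) RE-KEYED (appended, conv-1 GEN 29; pen RC-373 (b′) after triage r1-1 GEN 19 Δ19-2 / ruling R-b) — the Poitou–Tate injection `δ` is
`θ`-SEMILINEAR for a constant-fixing ring automorphism `θ` of `Λ` (the local duality `𝐇¹_loc ⧸ L ↪ ker(X_Gr ↠ X_fine)` sends the covariant,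
`κ`-keyed `J.H` to the contragredient, `κK`-keyed dual: `θ = ι ∘ θ_u`, Iwasawa involution ∘ unit twist), exactly the keying of the lead's v4.5 datum
`TwoAdicKatoDeterminant.ThetaShapiroKatoGreenbergDatum` (fields `θ`, `θ_C`, `δ : _ →ₛₗ[θ] _`, p685845).  The v4.3-keyed binder above is the case
`θ = RingEquiv.refl` (`shapiroLatticePoitouTateAtTwoTheta_of`).  Memo tier unchanged (t2 packaging; the t1 Poitou–Tate fact over the K-level carrier
`Kato2004.IwasawaH1DataOver` / `locOver` — p686843 / p687594 / p688003 — with `L := range locOver` is the next step and will DERIVE this binder). -/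

/-- [MEMO tier, OPEN — pen RC-362 (B)(t2) / RC-373 (b′): PACKAGING, re-keyed per triage Δ19-2 repair R-b] **POITOU–TATE over `K_∞` for the BDP
structure with the SHAPIRO LATTICE and a `θ`-SEMILINEAR duality map, and loc-injectivity given cotorsion.**  Verbatim `ShapiroLatticePoitouTateAtTwo`
except conjunct (3): there are a ring automorphism `θ : Λ ≃+* Λ` FIXING THE CONSTANTS (`θ (C c) = C c`; so `θ`-semilinear maps are `ℤ₂`-linear and `λ`,
`μ` are blind to `θ` — kernel `TwoAdicKatoDeterminant.lambdaInvariant_eq_of_semilinear_bijective`, p686294) and a short exact sequence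
**`0 → J.H ⧸ L →δ X_Gr →π X_fine → 0` with `δ` `θ`-SEMILINEAR injective** and `π` `Λ`-linear onto (intended: `θ = ι ∘ θ_u` with `u ∈ ℤ₂ˣ` the unit
relating `κK` to `κ ∘ res`; print has the Iwasawa involution here — the Λ-adic Poitou–Tate / Greenberg duality is `ι`-semilinear, `γ ↦ γ⁻¹`).
Nothing asserted.
-- TODO(general form): Poitou–Tate for an arbitrary pair of Selmer structures over a ℤ_p-extension of a number field, any `p`.
[cite: Rubin2000, Thm. 1.7.3 (the five-term global-duality sequence for Selmer structures F ⊂ G)] [cite: MazurRubin2004, Thm. 2.3.4]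
[cite: Greenberg2010, Prop. 3.1.1, Rem. 3.1.2, Prop. 2.2.9 (rank of the compact Selmer group of the dual structure; vanishing under cotorsion)]
[cite: Kato2004Asterisque, §17.13 (17.13.1)–(17.13.2) (the case over ℚ; shape)] [cite: NeukirchSchmidtWingberg2008, (1.6.4)] -/
@[conjecture] def ShapiroLatticePoitouTateAtTwoTheta : Prop :=
  ∀ (W : WeierstrassCurve ℚ) [W.IsElliptic] [ContinuousSMul ℤ_[2] (W.tateModule 2)]
    (K : Type) [Field K] [NumberField K], IsImaginaryQuadratic K → SatisfiesHeegnerHypothesis 2 K →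
    ∀ (A : WeierstrassCurve ℚ) [A.IsElliptic] [ContinuousSMul ℤ_[2] (A.tateModule 2)] (C : VariableChange ℚ),
      C • A = W.quadraticTwist ((NumberField.discr K : ℤ) : ℚ) →
    ∀ (w : HeightOneSpectrum (𝓞 K)), ((2 : ℕ) : 𝓞 K) ∈ w.asIdeal →
    ∀ (κ : ZpExtension ℚ 2) (γ : absoluteGaloisGroup ℚ), κ.IsCyclotomic → ∀ (hγ : κ.IsTopGenerator γ),
    ∀ (κK : ZpExtension K 2) (γK : absoluteGaloisGroup K), κK.IsCyclotomic → κK.IsTopGenerator γK →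
    ∀ (v : HeightOneSpectrum (𝓞 ℚ)), ((2 : ℕ) : 𝓞 ℚ) ∈ v.asIdeal →
    ∀ (γᵥ : absoluteGaloisGroup (v.adicCompletion ℚ))
      (hsurj : Function.Surjective
        (κ.toContinuousMonoidHom.comp (resGalOfEmb (closureEmb (K := ℚ) (v.adicCompletion ℚ)))))
      (hγᵥ : κ.IsTopGenerator (resGalOfEmb (closureEmb (K := ℚ) (v.adicCompletion ℚ)) γᵥ))
      (I_W : IwasawaH1Data W 2 κ γ) (I_A : IwasawaH1Data A 2 κ γ)
      (J : LocalIwasawaH1Data κ v ((tateRep W 2).toLocal v) γᵥ)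
      (J_A : LocalIwasawaH1Data κ v ((tateRep A 2).toLocal v) γᵥ)
      (DGr : (W.baseChange K).GreenbergStrictSelmerDualData κK γK
        (AcSelmer.bdpData (↥((W.baseChange K).geomPrimaryTorsion 2)) 2 w))
      (Dfi : (W.baseChange K).GreenbergStrictSelmerDualData κK γK
        (GreenbergSelmer.fineData (↥((W.baseChange K).geomPrimaryTorsion 2)) 2)),
    ∃ (uA : ((tateRep A 2).toLocal v).toTopRep ⟶ ((tateRep W 2).toLocal v).toTopRep),
      Function.Bijective uA.hom ∧
      ∃ (L : Submodule (IwasawaAlgebra 2) J.H),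
        LinearMap.range ((I_W.loc J hsurj hγ hγᵥ).coprod (J_A.map uA J ∘ₗ I_A.loc J_A hsurj hγ hγᵥ)) ≤ L ∧
        (∀ y ∈ L, (2 : IwasawaAlgebra 2) • y ∈
          LinearMap.range ((I_W.loc J hsurj hγ hγᵥ).coprod (J_A.map uA J ∘ₗ I_A.loc J_A hsurj hγ hγᵥ))) ∧
        (∃ (θ : IwasawaAlgebra 2 ≃+* IwasawaAlgebra 2) (_ : ∀ c : ℤ_[2], θ (PowerSeries.C c) = PowerSeries.C c)
            (δ : (J.H ⧸ L) →ₛₗ[(θ : IwasawaAlgebra 2 →+* IwasawaAlgebra 2)] DGr.X)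
            (π : DGr.X →ₗ[IwasawaAlgebra 2] Dfi.X),
          Function.Injective δ ∧ Function.Surjective π ∧ Function.Exact δ π) ∧
        (Module.Finite (IwasawaAlgebra 2) DGr.X → Module.IsTorsion (IwasawaAlgebra 2) DGr.X →
          Function.Injective
            ((I_W.loc J hsurj hγ hγᵥ).coprod (J_A.map uA J ∘ₗ I_A.loc J_A hsurj hγ hγᵥ)))

/-- **The v4.3-keyed binder implies the re-keyed one** (`θ := RingEquiv.refl Λ`, a `Λ`-linear `δ` read as `id`-semilinear): the re-keying WEAKENS
(PT), so nothing consumed by name is lost. [folklore] -/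
theorem shapiroLatticePoitouTateAtTwoTheta_of (h : ShapiroLatticePoitouTateAtTwo) : ShapiroLatticePoitouTateAtTwoTheta := by
  intro W _ _ K _ _ hK hH A _ _ C hA w hw κ γ hκ hγ κK γK hκK hγK v hv γᵥ hsurj hγᵥ I_W I_A J J_A DGr Dfi
  obtain ⟨uA, huA, L, hle, h2, ⟨δ, π, hδ, hπ, hex⟩, hinj⟩ :=
    h W K hK hH A C hA w hw κ γ hκ hγ κK γK hκK hγK v hv γᵥ hsurj hγᵥ I_W I_A J J_A DGr Dfi
  refine ⟨uA, huA, L, hle, h2, ⟨RingEquiv.refl _, fun _ ↦ rfl, ?_, π, ?_, hπ, ?_⟩, hinj⟩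
  · exact { toFun := δ, map_add' := δ.map_add, map_smul' := fun a x ↦ by rw [δ.map_smul]; rfl }
  · exact hδ
  · exact hex

end Summit.BirchSwinnertonDyer.BirchSwinnertonDyer.Theorems.TwoAdicShapiroPT
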